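import Mathlib.Probability.ProductMeasure
import Mathlib.Probability.UniformOn
import Mathlib.LinearAlgebra.FreeModule.Finite.Basic
import Mathlib.LinearAlgebra.FreeModule.PID
import Mathlib.Data.ZMod.Basic
import Mathlib.MeasureTheory.MeasurableSpace.Instances
import Mathlib.Analysis.SpecificLimits.Basic
import Mathlib.Analysis.SpecialFunctions.Log.Basic
import Literature.Barriers.CriticalPhenomena.TimarCriticalNonunimodular
import HarnessLib

/-!
# Timár 2006, Prop. 5.4: an invariant random exhaustion of the level group `≅ ℤⁿ` by finite
# partitions — PROVED

Barrier catalogue `Literature/Barriers/CriticalPhenomena/`; a brick of the programme proving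
Timár's Thm. 5.5 (`Timar2006_finiteLevelUnion`, `TimarCriticalNonunimodular.lean`). Á. Timár,
*Percolation on nonunimodular transitive graphs*, Ann. Probab. 34 (2006) 2344–2364, §5
(arXiv:math/0702875v1, p. 15):

> "Consider the set `R := {log_μ w(ℓ) : ℓ is a level of G}`. Note that `R` is an additive
> subgroup of `ℝ`, generated by the elements of `{log_μ (w(x)/w(y)) : x and y are adjacent}`,
> which is finite because `G` is locally finite. Since `R` is torsion-free, it is isomorphic to
> `ℤⁿ` for some `n`. Fix some isomorphism. Note that any automorphism of `G` acts on the weights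
> of the levels by multiplying them with a constant, so it acts on `R` by adding some constant. …
>
> **Proposition 5.4.** There exists an invariant random exhaustion of the levels of `G` by a
> sequence of finite partitions, that is, there exists an invariant random sequence `(P_i)_i`
> such that for every `i`, the `P_i` partitions the set of levels of `G` into finite sets and
> any two levels are in the same class of `P_i` with probability tending to 1 as `i → ∞`.
>
> *Proof.* It is enough to prove that there exists an invariant exhaustion for `ℤⁿ` by
> partitions consisting of finite classes (later called finite partitions). Then the
> isomorphism between `R` and `ℤⁿ` will transfer the exhaustion to the levels. … Let `P_m`
> consist of the following classes. Choose an `x ∈ {1, 2, …, m}ⁿ` uniformly at random and let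
> vertices `v, w ∈ ℤⁿ` be in the same class of the partition iff `⌊(v_i - x_i)/m⌋ = ⌊(w_i - x_i)/m⌋`
> for every `i ∈ {1, …, n}`. It is easy to see that the sequence of partitions defined this way
> satisfies the required properties. □

This file formalises the printed construction as an explicit probability space with an explicit
measure-preserving action, in the group-theoretic generality the transfer step needs (any
finitely generated free abelian group `Λ`; the level group `R` above is one, being a finitely
generated subgroup of `ℝ`), so that the assembly of Thm. 5.5 can place it as one factor of its
product space (cf. `TimarMassTransport.lean`: "the product space carrying the percolation, the
1-partition, labels and the exhaustion").

## Contents (namespace `Literature.Barriers.CriticalPhenomena`)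

The box exhaustion of `ℤ^ι` (`ι` a finite type of coordinates):
* `BoxSeeds ι = Π m, ι → ZMod (m+1)` — the seeds: for every scale `m` (side length `m + 1`) an
  offset `x ∈ (ℤ/(m+1))^ι` ("choose an `x ∈ {1, …, m}ⁿ` uniformly at random", independently over
  the scales); `boxSeedMeasure ι` — the product of the uniform laws (`Measure.infinitePi`);
* `boxShift u` — the action of `u ∈ ℤ^ι` on seeds (`x ↦ x + u mod (m+1)` at every scale); it is
  an action by measurable, measure-preserving maps (`boxShift_add`, `boxShift_zero`,
  `measurable_boxShift`, `boxSeedMeasure_map_boxShift`);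
* `boxIndex m ξ v = (⌊(v_i - x_i)/(m+1)⌋)_i` and the partition `BoxRel m ξ` it induces
  (`boxRel_equivalence`), with FINITE classes (`finite_setOf_boxRel`), EQUIVARIANT under the
  shift (`boxRel_boxShift_iff`: `v + u ∼ w + u` for the shifted seed iff `v ∼ w`), measurable in
  the seed (`measurableSet_setOf_boxRel`);
* the exhaustion property: `P[v ≁_m w] ≤ (Σ_i |v_i - w_i|)/(m+1)` (`measure_not_boxRel_le`),
  hence `P[v ∼_m w] → 1` (`tendsto_measure_boxRel`).

The transfer to a finitely generated free abelian group `Λ` ("the isomorphism between `R` and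
`ℤⁿ` will transfer the exhaustion"): `levelCoord Λ : Λ ≃ₗ[ℤ] (ι → ℤ)` for the index type
`ι = Module.Free.ChooseBasisIndex ℤ Λ` of a chosen basis, `ExhaustionRel`, `exhaustionShift` and
the same list of properties (`exhaustionRel_equivalence`, `finite_setOf_exhaustionRel`,
`exhaustionRel_exhaustionShift_iff`, `measurableSet_setOf_exhaustionRel`,
`boxSeedMeasure_map_exhaustionShift`, `tendsto_measure_exhaustionRel`), and the packaged
statement `Timar2006_prop54` (an existential over the probability space, for any such `Λ`);
finitely generated additive subgroups of `ℝ` qualify (`moduleFinite_of_addSubgroup_fg`,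
`moduleFree_of_addSubgroup_real_fg`, `Timar2006_prop54_real`).

The levels of a connected, locally finite, transitive graph `G` (the printed setting), in the
tree's vocabulary (`autWeight`, `SameLevel`, `levelUnion`): heights `levelHeight G o x = log w_o(x)`
(`sameLevel_iff_levelHeight_eq`; `levelHeight_map`: `h(γ v) = h(v) + h(γ o)`), the level group
`levelGroup G o` (`= R`, finitely generated, a finite free `ℤ`-module; `levelHeight_mem_levelGroup`),
the level of a vertex read in `R` (`levelElt`) and the translation constants `autHeight γ`
(`levelElt_map`, `autHeight_trans`); the exhaustion of the levels `LevelExhaustionRel G hconn ht o m ξ`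
with the action `levelExhaustionAct` of `Aut(G)` on the seeds, and its properties
(`levelExhaustionRel_equivalence`, `levelExhaustionRel_of_sameLevel`,
`exists_setOf_levelExhaustionRel_eq_levelUnion` — classes are finite unions of levels,
`levelExhaustionRel_act_iff` — invariance, `measurePreserving_levelExhaustionAct`,
`measurableSet_setOf_levelExhaustionRel`, `tendsto_measure_levelExhaustionRel`), packaged as
`Timar2006_prop54_levels`.

## References

* Á. Timár, Ann. Probab. 34 (2006) 2344–2364 (arXiv:math/0702875v1), §5: the paragraph before
  Prop. 5.4 (the level group `R ≅ ℤⁿ`, the action of `Aut(G)` by translations), Prop. 5.4 and its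
  proof (p. 15 of the arXiv reprint); use in the proof of Thm. 5.5 (p. 17: the exhaustion `R_i`).
  [Timar2006]
-/

noncomputable section

namespace Literature.Barriers.CriticalPhenomena

open _root_.MeasureTheory _root_.ProbabilityTheory _root_.Filter _root_.Topology

open scoped ENNReal

/-! ### The seeds and their law -/

section BoxExhaustion

variable (ι : Type*)

/-- The **seeds** of the box exhaustion of `ℤ^ι`: for every scale `m : ℕ` (boxes of side length
`m + 1`) an offset in `(ℤ/(m+1)ℤ)^ι` ("Choose an `x ∈ {1, 2, …, m}ⁿ` uniformly at random", one
for each partition `P_m`). [cite: Timar2006, Prop. 5.4 (proof)] -/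
abbrev BoxSeeds : Type _ := ∀ m : ℕ, ι → ZMod (m + 1)

/-- The **law of the seeds**: independently over the scales `m` and the coordinates `i`, the
offset `x_{m,i}` is uniform on `ℤ/(m+1)ℤ` (so that `x_m` is uniform on `(ℤ/(m+1)ℤ)^ι`).
[cite: Timar2006, Prop. 5.4 (proof: "uniformly at random")] -/
def boxSeedMeasure : Measure (BoxSeeds ι) :=
  Measure.infinitePi fun m : ℕ =>
    Measure.infinitePi fun _ : ι => uniformOn (Set.univ : Set (ZMod (m + 1)))

/-- The law of the seeds is a probability measure. [folklore] -/
instance isProbabilityMeasure_boxSeedMeasure : IsProbabilityMeasure (boxSeedMeasure ι) := by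
  unfold boxSeedMeasure; infer_instance

variable {ι}

/-- The uniform law on `ℤ/(m+1)ℤ` is invariant under translations. [folklore] -/
theorem uniformOn_univ_map_add_const (m : ℕ) (c : ZMod (m + 1)) :
    (uniformOn (Set.univ : Set (ZMod (m + 1)))).map (fun x => x + c) =
      uniformOn (Set.univ : Set (ZMod (m + 1))) := by
  ext s _
  rw [Measure.map_apply (Measurable.of_discrete) (MeasurableSet.of_discrete), uniformOn_univ,
    uniformOn_univ, Measure.count_apply MeasurableSet.of_discrete,
    Measure.count_apply MeasurableSet.of_discrete]
  congr 1
  have h : (fun x : ZMod (m + 1) => x + c) ⁻¹' s = (Equiv.addRight c).symm '' s := by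
    rw [Equiv.image_symm_eq_preimage]
    rfl
  rw [h, (Equiv.addRight c).symm.injective.encard_image]

/-! ### The action of `ℤ^ι` on the seeds -/

/-- The **shift** of the seeds by `u ∈ ℤ^ι`: at every scale the offset is translated by
`u mod (m+1)` — the action through which a translation of `ℤⁿ` acts on the random partitions.
[cite: Timar2006, Prop. 5.4 (proof) and the paragraph before it (invariance)] -/
def boxShift (u : ι → ℤ) (ξ : BoxSeeds ι) : BoxSeeds ι := fun m i => ξ m i + (u i : ZMod (m + 1))

/-- The shift, coordinatewise. [folklore] -/
@[simp] theorem boxShift_apply (u : ι → ℤ) (ξ : BoxSeeds ι) (m : ℕ) (i : ι) :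
    boxShift u ξ m i = ξ m i + (u i : ZMod (m + 1)) := rfl

/-- The shift is an action: `(u + u') • ξ = u • (u' • ξ)`. [folklore] -/
theorem boxShift_add (u u' : ι → ℤ) (ξ : BoxSeeds ι) :
    boxShift (u + u') ξ = boxShift u (boxShift u' ξ) := by
  funext m i
  simp only [boxShift_apply, Pi.add_apply, Int.cast_add]
  abel

/-- The shift by `0` is the identity. [folklore] -/
@[simp] theorem boxShift_zero (ξ : BoxSeeds ι) : boxShift 0 ξ = ξ := by
  funext m i
  simp

/-- The shift by `-u` undoes the shift by `u`. [folklore] -/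
@[simp] theorem boxShift_neg_boxShift (u : ι → ℤ) (ξ : BoxSeeds ι) :
    boxShift (-u) (boxShift u ξ) = ξ := by
  rw [← boxShift_add, neg_add_cancel, boxShift_zero]

/-- The shift is measurable. [folklore] -/
theorem measurable_boxShift (u : ι → ℤ) : Measurable (boxShift (ι := ι) u) := by
  refine measurable_pi_lambda _ fun m => measurable_pi_lambda _ fun i => ?_
  have h : (fun ξ : BoxSeeds ι => boxShift u ξ m i) =
      (fun y : ZMod (m + 1) => y + (u i : ZMod (m + 1))) ∘ fun ξ => ξ m i := rfl
  rw [h]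
  exact (Measurable.of_discrete).comp ((measurable_pi_apply i).comp (measurable_pi_apply m))

/-- Coordinatewise translation of `(ℤ/(m+1)ℤ)^ι` is measurable. [folklore] -/
theorem measurable_pi_add_const (m : ℕ) (c : ι → ZMod (m + 1)) :
    Measurable fun (x : ι → ZMod (m + 1)) (i : ι) => x i + c i :=
  measurable_pi_lambda _ fun i =>
    (Measurable.of_discrete (f := fun y : ZMod (m + 1) => y + c i)).comp (measurable_pi_apply i)

variable (ι) in
/-- **The law of the seeds is invariant under the shifts** (each coordinate law is translation
invariant, and the product measure is mapped coordinatewise; `Measure.infinitePi_map_pi`).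
[cite: Timar2006, Prop. 5.4 (proof: invariance of the random partitions)] -/
theorem boxSeedMeasure_map_boxShift (u : ι → ℤ) :
    (boxSeedMeasure ι).map (boxShift u) = boxSeedMeasure ι := by
  unfold boxSeedMeasure
  have h : boxShift (ι := ι) u =
      fun (ξ : BoxSeeds ι) (m : ℕ) => (fun (x : ι → ZMod (m + 1)) (i : ι) =>
        (fun y : ZMod (m + 1) => y + (u i : ZMod (m + 1))) (x i)) (ξ m) := rfl
  rw [h, Measure.infinitePi_map_pi
    (μ := fun m : ℕ => Measure.infinitePi fun _ : ι => uniformOn (Set.univ : Set (ZMod (m + 1))))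
    (fun m => measurable_pi_add_const m fun i => (u i : ZMod (m + 1)))]
  congr 1
  funext m
  have h2 := Measure.infinitePi_map_pi (μ := fun _ : ι => uniformOn (Set.univ : Set (ZMod (m + 1))))
    (f := fun (i : ι) (y : ZMod (m + 1)) => y + (u i : ZMod (m + 1))) (fun i => Measurable.of_discrete)
  refine h2.trans ?_
  congr 1
  funext i
  exact uniformOn_univ_map_add_const m _

/-- The shifts preserve the law of the seeds (bundled form). [folklore] -/
theorem measurePreserving_boxShift (u : ι → ℤ) :
    MeasurePreserving (boxShift u) (boxSeedMeasure ι) (boxSeedMeasure ι) :=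
  ⟨measurable_boxShift u, boxSeedMeasure_map_boxShift ι u⟩

/-! ### The random partitions `P_m` -/

/-- The **box index** of `v ∈ ℤ^ι` at scale `m` for the seed `ξ`: coordinatewise
`⌊(v_i - x_i)/(m+1)⌋`, where `x_i ∈ {0, …, m}` is the offset. [cite: Timar2006, Prop. 5.4 (proof)] -/
def boxIndex (m : ℕ) (ξ : BoxSeeds ι) (v : ι → ℤ) : ι → ℤ :=
  fun i => (v i - ((ξ m i).val : ℤ)) / ((m : ℤ) + 1)

/-- The **random partition `P_m`**: `v` and `w` are in the same class iff their box indices agree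
("`v, w ∈ ℤⁿ` [are] in the same class of the partition iff `⌊(v_i - x_i)/m⌋ = ⌊(w_i - x_i)/m⌋` for
every `i`"). [cite: Timar2006, Prop. 5.4 (proof)] -/
def BoxRel (m : ℕ) (ξ : BoxSeeds ι) (v w : ι → ℤ) : Prop :=
  boxIndex m ξ v = boxIndex m ξ w

/-- Unfolding of the box relation, coordinatewise. [cite: Timar2006, Prop. 5.4 (proof)] -/
theorem boxRel_iff {m : ℕ} {ξ : BoxSeeds ι} {v w : ι → ℤ} :
    BoxRel m ξ v w ↔ ∀ i, (v i - ((ξ m i).val : ℤ)) / ((m : ℤ) + 1) =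
      (w i - ((ξ m i).val : ℤ)) / ((m : ℤ) + 1) := by
  simp only [BoxRel, boxIndex, funext_iff]

/-- Each `P_m` is a partition (an equivalence relation: the kernel of the box index). [folklore] -/
theorem boxRel_equivalence (m : ℕ) (ξ : BoxSeeds ι) : Equivalence (BoxRel m ξ) :=
  ⟨fun _ => rfl, fun h => h.symm, fun h₁ h₂ => h₁.trans h₂⟩

/-- The box relation is reflexive. [folklore] -/
theorem boxRel_refl (m : ℕ) (ξ : BoxSeeds ι) (v : ι → ℤ) : BoxRel m ξ v v := rfl

/-- The box relation is symmetric. [folklore] -/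
theorem BoxRel.symm {m : ℕ} {ξ : BoxSeeds ι} {v w : ι → ℤ} (h : BoxRel m ξ v w) : BoxRel m ξ w v :=
  Eq.symm h

/-- The box relation is transitive. [folklore] -/
theorem BoxRel.trans {m : ℕ} {ξ : BoxSeeds ι} {v w z : ι → ℤ} (h₁ : BoxRel m ξ v w)
    (h₂ : BoxRel m ξ w z) : BoxRel m ξ v z :=
  Eq.trans h₁ h₂

/-- Two integers with the same quotient by `d > 0` are less than `d` apart. [folklore] -/
theorem int_sub_lt_of_ediv_eq {a b d : ℤ} (hd : 0 < d) (h : a / d = b / d) : a - b < d := by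
  have ha := Int.emod_add_mul_ediv a d
  have hb := Int.emod_add_mul_ediv b d
  have h1 := Int.emod_lt_of_pos a hd
  have h2 := Int.emod_nonneg b hd.ne'
  rw [h] at ha
  omega

/-- **The classes of `P_m` are finite**: a class lies in a box of side `m + 1`. [cite: Timar2006, Prop. 5.4 ("finite partitions")] -/
theorem finite_setOf_boxRel [Finite ι] (m : ℕ) (ξ : BoxSeeds ι) (v : ι → ℤ) :
    {w | BoxRel m ξ v w}.Finite := by
  have hd : (0 : ℤ) < (m : ℤ) + 1 := by positivity
  refine (Set.Finite.pi (t := fun i => Set.Ioo (v i - ((m : ℤ) + 1)) (v i + ((m : ℤ) + 1)))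
    fun i => Set.finite_Ioo _ _).subset ?_
  intro w hw
  simp only [Set.mem_pi, Set.mem_univ, Set.mem_Ioo, forall_const]
  intro i
  have h := (boxRel_iff.1 hw) i
  have h1 := int_sub_lt_of_ediv_eq hd h
  have h2 := int_sub_lt_of_ediv_eq hd h.symm
  constructor <;> omega

/-- The offset of a shifted seed: `val (x + u) = val x + u - (m+1) k` with
`k = ⌊(val x + u)/(m+1)⌋`. [folklore] -/
theorem val_boxShift (u : ι → ℤ) (ξ : BoxSeeds ι) (m : ℕ) (i : ι) :
    ((boxShift u ξ m i).val : ℤ) =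
      ((ξ m i).val : ℤ) + u i - ((m : ℤ) + 1) * ((((ξ m i).val : ℤ) + u i) / ((m : ℤ) + 1)) := by
  have hcast : boxShift u ξ m i = ((((ξ m i).val : ℤ) + u i : ℤ) : ZMod (m + 1)) := by
    simp only [boxShift_apply, Int.cast_add, Int.cast_natCast, ZMod.natCast_zmod_val]
  rw [hcast, ZMod.val_intCast]
  have h := Int.emod_add_mul_ediv (((ξ m i).val : ℤ) + u i) ((m : ℤ) + 1)
  have hm : ((m + 1 : ℕ) : ℤ) = (m : ℤ) + 1 := by push_cast; ring
  rw [hm]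
  linarith

/-- The box index of a translated point for the shifted seed differs from the original box index
by a constant NOT depending on the point. [folklore] -/
theorem boxIndex_boxShift (m : ℕ) (ξ : BoxSeeds ι) (u v : ι → ℤ) :
    boxIndex m (boxShift u ξ) (v + u) =
      boxIndex m ξ v + fun i => (((ξ m i).val : ℤ) + u i) / ((m : ℤ) + 1) := by
  funext i
  have hd : ((m : ℤ) + 1) ≠ 0 := by positivity
  simp only [boxIndex, Pi.add_apply, val_boxShift]
  set k : ℤ := (((ξ m i).val : ℤ) + u i) / ((m : ℤ) + 1) with hk
  have h : v i + u i - (((ξ m i).val : ℤ) + u i - ((m : ℤ) + 1) * k) =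
      v i - ((ξ m i).val : ℤ) + k * ((m : ℤ) + 1) := by ring
  rw [h, Int.add_mul_ediv_right _ _ hd]

/-- **The partitions are invariant**: translating both points by `u` and shifting the seed by `u`
does not change the relation ("any automorphism … acts on `R` by adding some constant"; the
random sequence `(P_i)` is invariant). [cite: Timar2006, Prop. 5.4 and the paragraph before it] -/
theorem boxRel_boxShift_iff (m : ℕ) (ξ : BoxSeeds ι) (u v w : ι → ℤ) :
    BoxRel m (boxShift u ξ) (v + u) (w + u) ↔ BoxRel m ξ v w := by
  simp only [BoxRel, boxIndex_boxShift, add_left_inj]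

/-- Variant of `boxRel_boxShift_iff` with the translation written on the left. [folklore] -/
theorem boxRel_boxShift_iff' (m : ℕ) (ξ : BoxSeeds ι) (u v w : ι → ℤ) :
    BoxRel m (boxShift u ξ) (u + v) (u + w) ↔ BoxRel m ξ v w := by
  rw [add_comm u v, add_comm u w, boxRel_boxShift_iff]

/-- The relation at scale `m` only depends on the scale-`m` offset. [folklore] -/
theorem setOf_boxRel_eq_iInter (m : ℕ) (v w : ι → ℤ) :
    {ξ : BoxSeeds ι | BoxRel m ξ v w} = ⋂ i : ι, (fun ξ : BoxSeeds ι => ξ m i) ⁻¹'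
      {x : ZMod (m + 1) | (v i - (x.val : ℤ)) / ((m : ℤ) + 1) = (w i - (x.val : ℤ)) / ((m : ℤ) + 1)} := by
  ext ξ
  simp only [Set.mem_setOf_eq, Set.mem_iInter, Set.mem_preimage, boxRel_iff]

/-- The events "`v ∼_m w`" are measurable in the seed. [folklore] -/
theorem measurableSet_setOf_boxRel [Countable ι] (m : ℕ) (v w : ι → ℤ) :
    MeasurableSet {ξ : BoxSeeds ι | BoxRel m ξ v w} := by
  rw [setOf_boxRel_eq_iInter]
  exact MeasurableSet.iInter fun i =>
    ((measurable_pi_apply i).comp (measurable_pi_apply m)) MeasurableSet.of_discrete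


/-! ### The exhaustion property: `P[v ∼_m w] → 1` -/

/-- **Where two integers get separated.** If `a ≤ b` receive different box indices for the
offset `x`, then some box boundary `t ≡ x (mod m+1)` lies in `(a, b]`. [folklore] -/
theorem exists_boundary_of_ediv_ne {a b x d : ℤ} (hd : 0 < d) (hab : a ≤ b)
    (h : (a - x) / d ≠ (b - x) / d) : ∃ t ∈ Set.Ioc a b, (d : ℤ) ∣ (t - x) := by
  set q := (b - x) / d with hq
  refine ⟨d * q + x, ⟨?_, ?_⟩, ⟨q, by ring⟩⟩
  · -- `a - x < d q` since `(a - x)/d < q`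
    have hlt : (a - x) / d < q := lt_of_le_of_ne (Int.ediv_le_ediv hd (by omega)) h
    have h1 := Int.emod_add_mul_ediv (a - x) d
    have h2 := Int.emod_lt_of_pos (a - x) hd
    have h3 : (a - x) / d + 1 ≤ q := hlt
    nlinarith
  · have h1 := Int.emod_add_mul_ediv (b - x) d
    have h2 := Int.emod_nonneg (b - x) hd.ne'
    linarith

/-- The set of residues mod `m + 1` of the integers in `(a, b]`: at most `b - a` of them.
[folklore] -/
theorem encard_boundaryResidues_le (m : ℕ) (a b : ℤ) :
    {x : ZMod (m + 1) | ∃ t ∈ Set.Ioc a b, (t : ZMod (m + 1)) = x}.encard ≤ ((b - a).toNat : ℕ∞) := by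
  classical
  have h : {x : ZMod (m + 1) | ∃ t ∈ Set.Ioc a b, (t : ZMod (m + 1)) = x} =
      (fun t : ℤ => (t : ZMod (m + 1))) '' (Set.Ioc a b) := by
    ext x; simp only [Set.mem_setOf_eq, Set.mem_image]
  rw [h]
  calc ((fun t : ℤ => (t : ZMod (m + 1))) '' Set.Ioc a b).encard
      ≤ (Set.Ioc a b).encard := Set.encard_image_le _ _
    _ = ((b - a).toNat : ℕ∞) := by
        rw [← Finset.coe_Ioc, Set.encard_coe_eq_coe_finsetCard, Int.card_Ioc]

/-- The one-coordinate separation event has probability at most `|v_i - w_i|/(m+1)` under the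
uniform offset. [cite: Timar2006, Prop. 5.4 (proof: "with probability tending to 1")] -/
theorem uniformOn_boundaryResidues_le (m : ℕ) (a b : ℤ) :
    uniformOn (Set.univ : Set (ZMod (m + 1)))
        {x : ZMod (m + 1) | ∃ t ∈ Set.Ioc (min a b) (max a b), (t : ZMod (m + 1)) = x} ≤
      ((a - b).natAbs : ℝ≥0∞) / ((m : ℝ≥0∞) + 1) := by
  rw [uniformOn_univ, Measure.count_apply MeasurableSet.of_discrete, ZMod.card]
  have h := encard_boundaryResidues_le m (min a b) (max a b)
  have hnat : (max a b - min a b).toNat = (a - b).natAbs := by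
    rcases le_total a b with hab | hab
    · rw [max_eq_right hab, min_eq_left hab]; omega
    · rw [max_eq_left hab, min_eq_right hab]; omega
  rw [hnat] at h
  have h' : (({x : ZMod (m + 1) | ∃ t ∈ Set.Ioc (min a b) (max a b), (t : ZMod (m + 1)) = x}.encard :
      ℕ∞) : ℝ≥0∞) ≤ ((a - b).natAbs : ℝ≥0∞) := by
    have := ENat.toENNReal_le.2 h
    simpa using this
  have hm : ((m + 1 : ℕ) : ℝ≥0∞) = (m : ℝ≥0∞) + 1 := by push_cast; rfl
  rw [hm]
  gcongr

/-- The complement of "`v ∼_m w`" is covered by the one-coordinate separation events. [folklore] -/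
theorem setOf_not_boxRel_subset (m : ℕ) (v w : ι → ℤ) :
    {ξ : BoxSeeds ι | ¬ BoxRel m ξ v w} ⊆ ⋃ i : ι, (fun ξ : BoxSeeds ι => ξ m i) ⁻¹'
      {x : ZMod (m + 1) | ∃ t ∈ Set.Ioc (min (v i) (w i)) (max (v i) (w i)), (t : ZMod (m + 1)) = x} := by
  intro ξ hξ
  simp only [Set.mem_setOf_eq, boxRel_iff, not_forall] at hξ
  obtain ⟨i, hi⟩ := hξ
  simp only [Set.mem_iUnion, Set.mem_preimage, Set.mem_setOf_eq]
  refine ⟨i, ?_⟩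
  have hd : (0 : ℤ) < (m : ℤ) + 1 := by positivity
  set x : ℤ := ((ξ m i).val : ℤ) with hx
  have hxcast : ((x : ℤ) : ZMod (m + 1)) = ξ m i := by
    rw [hx, Int.cast_natCast, ZMod.natCast_zmod_val]
  -- order the two coordinates
  have key : ∀ a b : ℤ, a ≤ b → (a - x) / ((m : ℤ) + 1) ≠ (b - x) / ((m : ℤ) + 1) →
      ∃ t ∈ Set.Ioc a b, (t : ZMod (m + 1)) = ξ m i := by
    intro a b hab hne
    obtain ⟨t, ht, hdvd⟩ := exists_boundary_of_ediv_ne hd hab hne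
    refine ⟨t, ht, ?_⟩
    rw [← hxcast]
    have hm : ((m : ℤ) + 1) = ((m + 1 : ℕ) : ℤ) := by push_cast; ring
    rw [hm] at hdvd
    exact ((ZMod.intCast_eq_intCast_iff_dvd_sub x t (m + 1)).2 hdvd).symm
  rcases le_total (v i) (w i) with hvw | hvw
  · rw [min_eq_left hvw, max_eq_right hvw]
    exact key _ _ hvw hi
  · rw [min_eq_right hvw, max_eq_left hvw]
    exact key _ _ hvw (Ne.symm hi)

variable (ι) in
/-- The marginal of the seed law at scale `m`, coordinate `i` is uniform. [folklore] -/
theorem boxSeedMeasure_map_eval (m : ℕ) (i : ι) :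
    (boxSeedMeasure ι).map (fun ξ : BoxSeeds ι => ξ m i) = uniformOn (Set.univ : Set (ZMod (m + 1))) := by
  have h : (fun ξ : BoxSeeds ι => ξ m i) = (fun x : ι → ZMod (m + 1) => x i) ∘ fun ξ : BoxSeeds ι => ξ m := rfl
  rw [h, ← Measure.map_map (measurable_pi_apply i) (measurable_pi_apply m), boxSeedMeasure,
    Measure.infinitePi_map_eval
      (μ := fun m : ℕ => Measure.infinitePi fun _ : ι => uniformOn (Set.univ : Set (ZMod (m + 1)))) m,
    Measure.infinitePi_map_eval (μ := fun _ : ι => uniformOn (Set.univ : Set (ZMod (m + 1)))) i]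

variable [Fintype ι]

variable (ι) in
/-- **The exhaustion estimate**: `P[v ≁_m w] ≤ (Σ_i |v_i - w_i|)/(m+1)` — `v` and `w` are
separated at scale `m` only if, in some coordinate, one of the at most `|v_i - w_i|` box
boundaries between them is hit by the uniform offset.
[cite: Timar2006, Prop. 5.4 (proof: "with probability tending to 1 as i → ∞")] -/
theorem measure_not_boxRel_le (m : ℕ) (v w : ι → ℤ) :
    boxSeedMeasure ι {ξ | ¬ BoxRel m ξ v w} ≤
      (∑ i : ι, ((v i - w i).natAbs : ℝ≥0∞)) / ((m : ℝ≥0∞) + 1) := by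
  calc boxSeedMeasure ι {ξ | ¬ BoxRel m ξ v w}
      ≤ boxSeedMeasure ι (⋃ i : ι, (fun ξ : BoxSeeds ι => ξ m i) ⁻¹'
          {x : ZMod (m + 1) | ∃ t ∈ Set.Ioc (min (v i) (w i)) (max (v i) (w i)),
            (t : ZMod (m + 1)) = x}) := measure_mono (setOf_not_boxRel_subset m v w)
    _ ≤ ∑ i : ι, boxSeedMeasure ι ((fun ξ : BoxSeeds ι => ξ m i) ⁻¹'
          {x : ZMod (m + 1) | ∃ t ∈ Set.Ioc (min (v i) (w i)) (max (v i) (w i)),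
            (t : ZMod (m + 1)) = x}) := measure_iUnion_fintype_le _ _
    _ = ∑ i : ι, uniformOn (Set.univ : Set (ZMod (m + 1)))
          {x : ZMod (m + 1) | ∃ t ∈ Set.Ioc (min (v i) (w i)) (max (v i) (w i)),
            (t : ZMod (m + 1)) = x} := by
        refine Finset.sum_congr rfl fun i _ => ?_
        have hmeas : Measurable fun ξ : BoxSeeds ι => ξ m i :=
          (measurable_pi_apply i).comp (measurable_pi_apply m)
        rw [← boxSeedMeasure_map_eval ι m i, Measure.map_apply hmeas MeasurableSet.of_discrete]
    _ ≤ ∑ i : ι, ((v i - w i).natAbs : ℝ≥0∞) / ((m : ℝ≥0∞) + 1) :=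
        Finset.sum_le_sum fun i _ => uniformOn_boundaryResidues_le m (v i) (w i)
    _ = (∑ i : ι, ((v i - w i).natAbs : ℝ≥0∞)) / ((m : ℝ≥0∞) + 1) := by
        simp only [div_eq_mul_inv, Finset.sum_mul]

variable (ι) in
/-- The separation probability tends to `0` along the scales. [folklore] -/
theorem tendsto_measure_not_boxRel (v w : ι → ℤ) :
    Tendsto (fun m : ℕ => boxSeedMeasure ι {ξ | ¬ BoxRel m ξ v w}) atTop (𝓝 0) := by
  set C : ℝ≥0∞ := ∑ i : ι, ((v i - w i).natAbs : ℝ≥0∞) with hC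
  have hCT : C ≠ ⊤ := by
    rw [hC]
    exact ENNReal.sum_ne_top.2 fun i _ => ENNReal.natCast_ne_top _
  have hlim : Tendsto (fun m : ℕ => C / ((m : ℝ≥0∞) + 1)) atTop (𝓝 0) := by
    have h1 : Tendsto (fun m : ℕ => ((m : ℝ≥0∞) + 1)⁻¹) atTop (𝓝 0) := by
      have h := ENNReal.tendsto_inv_nat_nhds_zero
      have h' : Tendsto (fun m : ℕ => ((m + 1 : ℕ) : ℝ≥0∞)⁻¹) atTop (𝓝 0) :=
        h.comp (tendsto_add_atTop_nat 1)
      refine h'.congr fun m => ?_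
      push_cast
      rfl
    have h2 := ENNReal.Tendsto.const_mul h1 (Or.inr hCT)
    rw [mul_zero] at h2
    simpa [div_eq_mul_inv] using h2
  exact tendsto_of_tendsto_of_tendsto_of_le_of_le tendsto_const_nhds hlim (fun m => zero_le)
    fun m => measure_not_boxRel_le ι m v w

variable (ι) in
/-- **Prop. 5.4, the exhaustion property**: any two points of `ℤ^ι` are in the same class of the
`m`-th random partition with probability tending to `1`.
[cite: Timar2006, Prop. 5.4 ("with probability tending to 1 as i → ∞")] -/
theorem tendsto_measure_boxRel (v w : ι → ℤ) :
    Tendsto (fun m : ℕ => boxSeedMeasure ι {ξ | BoxRel m ξ v w}) atTop (𝓝 1) := by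
  have h : ∀ m : ℕ, boxSeedMeasure ι {ξ | BoxRel m ξ v w} =
      1 - boxSeedMeasure ι {ξ | ¬ BoxRel m ξ v w} := by
    intro m
    have hc : {ξ : BoxSeeds ι | ¬ BoxRel m ξ v w} = {ξ | BoxRel m ξ v w}ᶜ := rfl
    rw [hc, prob_compl_eq_one_sub (measurableSet_setOf_boxRel m v w),
      ENNReal.sub_sub_cancel ENNReal.one_ne_top prob_le_one]
  simp_rw [h]
  have h1 := ENNReal.Tendsto.sub (tendsto_const_nhds (x := (1 : ℝ≥0∞)))
    (tendsto_measure_not_boxRel ι v w) (Or.inl ENNReal.one_ne_top)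
  rwa [tsub_zero] at h1

/-- The exhaustion estimate in closed form: `P[v ∼_m w] ≥ 1 - (Σ_i |v_i - w_i|)/(m+1)`.
[cite: Timar2006, Prop. 5.4 (proof)] -/
theorem one_sub_le_measure_boxRel (m : ℕ) (v w : ι → ℤ) :
    1 - (∑ i : ι, ((v i - w i).natAbs : ℝ≥0∞)) / ((m : ℝ≥0∞) + 1) ≤
      boxSeedMeasure ι {ξ | BoxRel m ξ v w} := by
  have hc : {ξ : BoxSeeds ι | ¬ BoxRel m ξ v w} = {ξ | BoxRel m ξ v w}ᶜ := rfl
  have h : boxSeedMeasure ι {ξ | BoxRel m ξ v w} = 1 - boxSeedMeasure ι {ξ | ¬ BoxRel m ξ v w} := by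
    rw [hc, prob_compl_eq_one_sub (measurableSet_setOf_boxRel m v w),
      ENNReal.sub_sub_cancel ENNReal.one_ne_top prob_le_one]
  rw [h]
  exact tsub_le_tsub_left (measure_not_boxRel_le ι m v w) 1

end BoxExhaustion

/-! ### Transfer to a finitely generated free abelian group

"Then the isomorphism between `R` and `ℤⁿ` will transfer the exhaustion to the levels": for any
finitely generated free `ℤ`-module `Λ` we fix a basis (`Module.Free.chooseBasis`) and pull the box
exhaustion back along the coordinate isomorphism `levelCoord Λ : Λ ≃ₗ[ℤ] ℤ^ι`. -/

section Transfer

universe u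

variable (Λ : Type u) [AddCommGroup Λ] [Module.Free ℤ Λ] [Module.Finite ℤ Λ]

/-- The coordinate index type of the chosen `ℤ`-basis of `Λ` (finite). [folklore] -/
abbrev LevelCoordIndex : Type u := Module.Free.ChooseBasisIndex ℤ Λ

/-- **"Fix some isomorphism"** `Λ ≅ ℤⁿ`: the coordinates in the chosen basis.
[cite: Timar2006, §5 (paragraph before Prop. 5.4: "it is isomorphic to ℤⁿ for some n. Fix some isomorphism")] -/
def levelCoord : Λ ≃ₗ[ℤ] (LevelCoordIndex Λ → ℤ) := (Module.Free.chooseBasis ℤ Λ).equivFun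

/-- The seeds of the exhaustion of `Λ` (those of the box exhaustion of `ℤ^ι`). [cite: Timar2006, Prop. 5.4 (proof)] -/
abbrev ExhaustionSeeds : Type u := BoxSeeds (LevelCoordIndex Λ)

variable {Λ}

/-- The action of `Λ` on the seeds, through the coordinates. [cite: Timar2006, Prop. 5.4 (proof)] -/
def exhaustionShift (a : Λ) : ExhaustionSeeds Λ → ExhaustionSeeds Λ := boxShift (levelCoord Λ a)

/-- **The random partitions `P_m` of `Λ`**, transferred from `ℤ^ι` along the coordinates.
[cite: Timar2006, Prop. 5.4] -/
def ExhaustionRel (m : ℕ) (ξ : ExhaustionSeeds Λ) (a b : Λ) : Prop :=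
  BoxRel m ξ (levelCoord Λ a) (levelCoord Λ b)

/-- Unfolding of the transferred relation. [folklore] -/
theorem exhaustionRel_iff {m : ℕ} {ξ : ExhaustionSeeds Λ} {a b : Λ} :
    ExhaustionRel m ξ a b ↔ BoxRel m ξ (levelCoord Λ a) (levelCoord Λ b) := Iff.rfl

/-- The action of `Λ` on the seeds is an action. [folklore] -/
theorem exhaustionShift_add (a b : Λ) (ξ : ExhaustionSeeds Λ) :
    exhaustionShift (a + b) ξ = exhaustionShift a (exhaustionShift b ξ) := by
  simp only [exhaustionShift, map_add, boxShift_add]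

/-- `0` acts trivially. [folklore] -/
@[simp] theorem exhaustionShift_zero (ξ : ExhaustionSeeds Λ) : exhaustionShift (0 : Λ) ξ = ξ := by
  simp only [exhaustionShift, map_zero, boxShift_zero]

/-- The action is by measurable maps. [folklore] -/
theorem measurable_exhaustionShift (a : Λ) : Measurable (exhaustionShift a) :=
  measurable_boxShift _

variable (Λ) in
/-- **The action preserves the law of the seeds.** [cite: Timar2006, Prop. 5.4 ("invariant")] -/
theorem boxSeedMeasure_map_exhaustionShift (a : Λ) :
    (boxSeedMeasure (LevelCoordIndex Λ)).map (exhaustionShift a) = boxSeedMeasure (LevelCoordIndex Λ) :=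
  boxSeedMeasure_map_boxShift _ _

/-- The action preserves the law of the seeds (bundled). [cite: Timar2006, Prop. 5.4 ("invariant")] -/
theorem measurePreserving_exhaustionShift (a : Λ) :
    MeasurePreserving (exhaustionShift a) (boxSeedMeasure (LevelCoordIndex Λ))
      (boxSeedMeasure (LevelCoordIndex Λ)) :=
  measurePreserving_boxShift _

/-- Each `P_m` is a partition of `Λ`. [cite: Timar2006, Prop. 5.4 ("partitions")] -/
theorem exhaustionRel_equivalence (m : ℕ) (ξ : ExhaustionSeeds Λ) : Equivalence (ExhaustionRel m ξ) :=
  ⟨fun _ => boxRel_refl _ _ _, fun h => BoxRel.symm h, fun h₁ h₂ => BoxRel.trans h₁ h₂⟩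

/-- The transferred relation is reflexive. [folklore] -/
theorem exhaustionRel_refl (m : ℕ) (ξ : ExhaustionSeeds Λ) (a : Λ) : ExhaustionRel m ξ a a :=
  (exhaustionRel_equivalence m ξ).refl a

/-- The transferred relation is symmetric. [folklore] -/
theorem ExhaustionRel.symm {m : ℕ} {ξ : ExhaustionSeeds Λ} {a b : Λ} (h : ExhaustionRel m ξ a b) :
    ExhaustionRel m ξ b a :=
  (exhaustionRel_equivalence m ξ).symm h

/-- The transferred relation is transitive. [folklore] -/
theorem ExhaustionRel.trans {m : ℕ} {ξ : ExhaustionSeeds Λ} {a b c : Λ} (h₁ : ExhaustionRel m ξ a b)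
    (h₂ : ExhaustionRel m ξ b c) : ExhaustionRel m ξ a c :=
  (exhaustionRel_equivalence m ξ).trans h₁ h₂

/-- **The classes of `P_m` are finite.** [cite: Timar2006, Prop. 5.4 ("finite partitions")] -/
theorem finite_setOf_exhaustionRel (m : ℕ) (ξ : ExhaustionSeeds Λ) (a : Λ) :
    {b : Λ | ExhaustionRel m ξ a b}.Finite := by
  have h : {b : Λ | ExhaustionRel m ξ a b} =
      (levelCoord Λ) ⁻¹' {w | BoxRel m ξ (levelCoord Λ a) w} := rfl
  rw [h]
  exact (finite_setOf_boxRel m ξ _).preimage (levelCoord Λ).injective.injOn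

/-- **The partitions are invariant under `Λ`**: `u + a ∼ u + b` for the seed shifted by `u` iff
`a ∼ b`. [cite: Timar2006, Prop. 5.4 ("invariant random sequence")] -/
theorem exhaustionRel_exhaustionShift_iff (m : ℕ) (ξ : ExhaustionSeeds Λ) (u a b : Λ) :
    ExhaustionRel m (exhaustionShift u ξ) (u + a) (u + b) ↔ ExhaustionRel m ξ a b := by
  simp only [ExhaustionRel, exhaustionShift, map_add, boxRel_boxShift_iff']

/-- Variant with the translation on the right. [folklore] -/
theorem exhaustionRel_exhaustionShift_iff' (m : ℕ) (ξ : ExhaustionSeeds Λ) (u a b : Λ) :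
    ExhaustionRel m (exhaustionShift u ξ) (a + u) (b + u) ↔ ExhaustionRel m ξ a b := by
  rw [add_comm a u, add_comm b u, exhaustionRel_exhaustionShift_iff]

/-- The events "`a ∼_m b`" are measurable. [folklore] -/
theorem measurableSet_setOf_exhaustionRel (m : ℕ) (a b : Λ) :
    MeasurableSet {ξ : ExhaustionSeeds Λ | ExhaustionRel m ξ a b} :=
  measurableSet_setOf_boxRel m _ _

variable (Λ) in
/-- **The exhaustion property**: `P[a ∼_m b] → 1`. [cite: Timar2006, Prop. 5.4] -/
theorem tendsto_measure_exhaustionRel (a b : Λ) :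
    Tendsto (fun m : ℕ => boxSeedMeasure (LevelCoordIndex Λ) {ξ | ExhaustionRel m ξ a b})
      atTop (𝓝 1) :=
  tendsto_measure_boxRel _ _ _

variable (Λ) in
/-- The exhaustion estimate for `Λ`, in the coordinates of the chosen basis. [folklore] -/
theorem one_sub_le_measure_exhaustionRel (m : ℕ) (a b : Λ) :
    1 - (∑ i, ((levelCoord Λ a i - levelCoord Λ b i).natAbs : ℝ≥0∞)) / ((m : ℝ≥0∞) + 1) ≤
      boxSeedMeasure (LevelCoordIndex Λ) {ξ | ExhaustionRel m ξ a b} :=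
  one_sub_le_measure_boxRel m _ _

/-- **Timár 2006, Prop. 5.4 (group form), PROVED.** Every finitely generated free abelian group
`Λ` (in the source: the level group `R ≅ ℤⁿ`) carries an invariant random exhaustion by finite
partitions: a probability space with a measure-preserving action of `Λ` and a sequence of random
equivalence relations with finite classes, jointly invariant, such that any two elements are
related at stage `m` with probability tending to `1`. Witness: the box exhaustion above.
[cite: Timar2006, Prop. 5.4] -/
theorem Timar2006_prop54 (Λ : Type u) [AddCommGroup Λ] [Module.Free ℤ Λ] [Module.Finite ℤ Λ] :
    ∃ (Ω : Type u) (_ : MeasurableSpace Ω) (P : Measure Ω) (_ : IsProbabilityMeasure P)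
      (act : Λ → Ω → Ω) (rel : ℕ → Ω → Λ → Λ → Prop),
      (∀ a b, act (a + b) = act a ∘ act b) ∧ act 0 = id ∧
      (∀ a, MeasurePreserving (act a) P P) ∧
      (∀ m ξ, Equivalence (rel m ξ)) ∧
      (∀ m ξ a, {b | rel m ξ a b}.Finite) ∧
      (∀ m ξ u a b, rel m (act u ξ) (u + a) (u + b) ↔ rel m ξ a b) ∧
      (∀ m a b, MeasurableSet {ξ | rel m ξ a b}) ∧
      (∀ a b, Tendsto (fun m => P {ξ | rel m ξ a b}) atTop (𝓝 1)) :=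
  ⟨ExhaustionSeeds Λ, inferInstance, boxSeedMeasure (LevelCoordIndex Λ), inferInstance,
    exhaustionShift, ExhaustionRel,
    fun a b => funext (exhaustionShift_add a b), funext exhaustionShift_zero,
    measurePreserving_exhaustionShift, exhaustionRel_equivalence, finite_setOf_exhaustionRel,
    exhaustionRel_exhaustionShift_iff, measurableSet_setOf_exhaustionRel,
    tendsto_measure_exhaustionRel Λ⟩

end Transfer

/-! ### Finitely generated subgroups of `ℝ` (the level group `R`)

"Note that `R` is an additive subgroup of `ℝ`, generated by [finitely many elements] … Since `R`
is torsion-free, it is isomorphic to `ℤⁿ` for some `n`": a finitely generated additive subgroup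
of `ℝ` is a finite free `ℤ`-module, so `Timar2006_prop54` applies to it. -/

section RealSubgroups

/-- A finitely generated additive subgroup, as a `ℤ`-module, is finite. [folklore] -/
theorem moduleFinite_of_addSubgroup_fg {M : Type*} [AddCommGroup M] {L : AddSubgroup M}
    (hL : L.FG) : Module.Finite ℤ L :=
  Module.Finite.iff_addGroup_fg.2 ((AddGroup.fg_iff_addSubgroup_fg L).2 hL)

/-- A finitely generated additive subgroup of `ℝ` is a free `ℤ`-module ("Since `R` is
torsion-free, it is isomorphic to `ℤⁿ`"). [cite: Timar2006, §5 (paragraph before Prop. 5.4)] -/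
theorem moduleFree_of_addSubgroup_real_fg {L : AddSubgroup ℝ} (hL : L.FG) : Module.Free ℤ L := by
  haveI := moduleFinite_of_addSubgroup_fg hL
  infer_instance

/-- **Prop. 5.4 for a finitely generated subgroup of `ℝ`** (the printed setting `R ⊆ ℝ`).
[cite: Timar2006, Prop. 5.4] -/
theorem Timar2006_prop54_real (L : AddSubgroup ℝ) (hL : L.FG) :
    ∃ (Ω : Type) (_ : MeasurableSpace Ω) (P : Measure Ω) (_ : IsProbabilityMeasure P)
      (act : L → Ω → Ω) (rel : ℕ → Ω → L → L → Prop),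
      (∀ a b, act (a + b) = act a ∘ act b) ∧ act 0 = id ∧
      (∀ a, MeasurePreserving (act a) P P) ∧
      (∀ m ξ, Equivalence (rel m ξ)) ∧
      (∀ m ξ a, {b | rel m ξ a b}.Finite) ∧
      (∀ m ξ u a b, rel m (act u ξ) (u + a) (u + b) ↔ rel m ξ a b) ∧
      (∀ m a b, MeasurableSet {ξ | rel m ξ a b}) ∧
      (∀ a b, Tendsto (fun m => P {ξ | rel m ξ a b}) atTop (𝓝 1)) := by
  haveI := moduleFinite_of_addSubgroup_fg hL
  haveI := moduleFree_of_addSubgroup_real_fg hL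
  exact Timar2006_prop54 L

end RealSubgroups

/-! ### The level group of a transitive graph and the exhaustion of its levels

"Consider the set `R := {log_μ w(ℓ) : ℓ is a level of G}`. Note that `R` is an additive subgroup
of `ℝ`, generated by the elements of `{log_μ (w(x)/w(y)) : x and y are adjacent}`, which is finite
because `G` is locally finite. … Note that any automorphism of `G` acts on the weights of the
levels by multiplying them with a constant, so it acts on `R` by adding some constant."
We use natural logarithms (the base only rescales `R`), the weights `w = autWeight G o` of the
tree (`MassTransportPrincipleQuasiTransitive.lean`, `TimarNonunimodularLevels.lean`) and, for
the level group, the subgroup generated by the heights of the neighbours of the base vertex `o`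
(it contains every height, `levelHeight_mem_levelGroup`, by transitivity along a walk from `o`). -/

section LevelGroup

open Literature.Probability.LatticeModels Literature.Probability.Percolation

variable {V : Type*}

/-- The **height** of a vertex: the logarithm of its weight `w_o(x)` ("`log_μ w(ℓ)`", up to the
base of the logarithm). [cite: Timar2006, §5 (the set R)] -/
def levelHeight (G : SimpleGraph V) (o x : V) : ℝ := Real.log (autWeight G o x).toReal

/-- The weights are positive reals. [folklore] -/
theorem toReal_autWeight_pos (G : SimpleGraph V) [G.LocallyFinite] (hconn : G.Connected) (o x : V) :
    0 < (autWeight G o x).toReal :=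
  ENNReal.toReal_pos (autWeight_ne_zero G hconn o x) (autWeight_ne_top G hconn o x)

/-- The base vertex has height `0`. [folklore] -/
theorem levelHeight_self (G : SimpleGraph V) [G.LocallyFinite] (hconn : G.Connected) (o : V) :
    levelHeight G o o = 0 := by
  rw [levelHeight, autWeight_self G hconn o, ENNReal.toReal_one, Real.log_one]

/-- **Two vertices are on the same level iff their heights agree** ("two vertices are on the same
level if and only if their weights are the same"). [cite: Timar2006, §2 and §5] -/
theorem sameLevel_iff_levelHeight_eq (G : SimpleGraph V) [G.LocallyFinite] (hconn : G.Connected)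
    (o x y : V) : SameLevel G x y ↔ levelHeight G o x = levelHeight G o y := by
  rw [sameLevel_iff_autWeight_eq G hconn o, levelHeight, levelHeight]
  constructor
  · intro h; rw [h]
  · intro h
    have h' := Real.log_injOn_pos (toReal_autWeight_pos G hconn o x) (toReal_autWeight_pos G hconn o y) h
    exact (ENNReal.toReal_eq_toReal_iff' (autWeight_ne_top G hconn o x) (autWeight_ne_top G hconn o y)).1 h'

/-- **Automorphisms shift all heights by one constant** ("any automorphism of `G` acts on the
weights of the levels by multiplying them with a constant, so it acts on `R` by adding some
constant"): `h(γ v) = h(v) + h(γ o)`. [cite: Timar2006, §5 (paragraph before Prop. 5.4)] -/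
theorem levelHeight_map (G : SimpleGraph V) [G.LocallyFinite] (hconn : G.Connected) (γ : G ≃g G)
    (o v : V) : levelHeight G o (γ v) = levelHeight G o v + levelHeight G o (γ o) := by
  have h := autWeight_map_mul G hconn γ o v o
  rw [autWeight_self G hconn o, mul_one] at h
  -- `w(γ v) = w(γ o) w(v)`
  rw [levelHeight, levelHeight, levelHeight, h, ENNReal.toReal_mul,
    Real.log_mul (toReal_autWeight_pos G hconn o (γ o)).ne' (toReal_autWeight_pos G hconn o v).ne',
    add_comm]

/-- Heights of adjacent vertices differ by the height of a neighbour of the base vertex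
(transitivity: move the edge to `o`). [cite: Timar2006, §5 ("generated by the elements of {log_μ w(x)/w(y) : x and y are adjacent}")] -/
theorem exists_levelHeight_sub_eq (G : SimpleGraph V) [G.LocallyFinite] (hconn : G.Connected)
    (ht : IsGraphTransitive G) (o : V) {a b : V} (hab : G.Adj a b) :
    ∃ y ∈ G.neighborSet o, levelHeight G o b - levelHeight G o a = levelHeight G o y := by
  obtain ⟨γ, hγ⟩ := ht a o
  refine ⟨γ b, ?_, ?_⟩
  · rw [SimpleGraph.mem_neighborSet, ← hγ]
    exact γ.map_rel_iff.2 hab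
  · have ha := levelHeight_map G hconn γ o a
    have hb := levelHeight_map G hconn γ o b
    rw [hγ, levelHeight_self G hconn o] at ha
    linarith

/-- The **level group** `R`: the additive subgroup of `ℝ` generated by the heights of the
neighbours of the base vertex ("generated by the elements of `{log_μ (w(x)/w(y)) : x and y are
adjacent}`, which is finite because `G` is locally finite"). [cite: Timar2006, §5 (the set R)] -/
def levelGroup (G : SimpleGraph V) [G.LocallyFinite] (o : V) : AddSubgroup ℝ :=
  AddSubgroup.closure (levelHeight G o '' G.neighborSet o)

/-- The level group is finitely generated. [cite: Timar2006, §5 ("which is finite because G is locally finite")] -/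
theorem levelGroup_fg (G : SimpleGraph V) [G.LocallyFinite] (o : V) : (levelGroup G o).FG := by
  classical
  refine ⟨(G.neighborFinset o).image (levelHeight G o), ?_⟩
  rw [levelGroup, Finset.coe_image, SimpleGraph.coe_neighborFinset]

/-- The level group is a finite `ℤ`-module … [folklore] -/
instance levelGroup.moduleFinite (G : SimpleGraph V) [G.LocallyFinite] (o : V) :
    Module.Finite ℤ (levelGroup G o) :=
  moduleFinite_of_addSubgroup_fg (levelGroup_fg G o)

/-- … and a free one ("Since `R` is torsion-free, it is isomorphic to `ℤⁿ` for some `n`").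
[cite: Timar2006, §5 (paragraph before Prop. 5.4)] -/
instance levelGroup.moduleFree (G : SimpleGraph V) [G.LocallyFinite] (o : V) :
    Module.Free ℤ (levelGroup G o) :=
  moduleFree_of_addSubgroup_real_fg (levelGroup_fg G o)

/-- **Every height lies in the level group** (`R ⊇ {log w(ℓ)}`; along a walk from `o` the height
changes by generators). [cite: Timar2006, §5 (the set R is a subgroup generated by the adjacent ratios)] -/
theorem levelHeight_mem_levelGroup (G : SimpleGraph V) [G.LocallyFinite] (hconn : G.Connected)
    (ht : IsGraphTransitive G) (o x : V) : levelHeight G o x ∈ levelGroup G o := by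
  obtain ⟨p⟩ := hconn.preconnected o x
  suffices h : ∀ (a b : V) (q : G.Walk a b), levelHeight G o b - levelHeight G o a ∈ levelGroup G o by
    have := h o x p
    rwa [levelHeight_self G hconn o, sub_zero] at this
  intro a b q
  induction q with
  | nil => rw [sub_self]; exact zero_mem _
  | @cons a c b hac q ih =>
    obtain ⟨y, hy, hyeq⟩ := exists_levelHeight_sub_eq G hconn ht o hac
    have hgen : levelHeight G o c - levelHeight G o a ∈ levelGroup G o := by
      rw [hyeq]
      exact AddSubgroup.subset_closure ⟨y, hy, rfl⟩
    have : levelHeight G o b - levelHeight G o a =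
        (levelHeight G o b - levelHeight G o c) + (levelHeight G o c - levelHeight G o a) := by ring
    rw [this]
    exact add_mem ih hgen

/-- The height of `x` as an element of the level group `R` (the level of `x`, read in `R ≅ ℤⁿ`).
[cite: Timar2006, §5 (the set R)] -/
def levelElt (G : SimpleGraph V) [G.LocallyFinite] (hconn : G.Connected) (ht : IsGraphTransitive G)
    (o x : V) : levelGroup G o :=
  ⟨levelHeight G o x, levelHeight_mem_levelGroup G hconn ht o x⟩

/-- The element of `R` attached to `x` is its height. [folklore] -/
@[simp] theorem coe_levelElt (G : SimpleGraph V) [G.LocallyFinite] (hconn : G.Connected)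
    (ht : IsGraphTransitive G) (o x : V) : (levelElt G hconn ht o x : ℝ) = levelHeight G o x := rfl

/-- The constant by which the automorphism `γ` translates `R`: the height of `γ o`.
[cite: Timar2006, §5 ("it acts on R by adding some constant")] -/
def autHeight (G : SimpleGraph V) [G.LocallyFinite] (hconn : G.Connected) (ht : IsGraphTransitive G)
    (o : V) (γ : G ≃g G) : levelGroup G o :=
  levelElt G hconn ht o (γ o)

/-- **`Aut(G)` acts on the levels, read in `R`, by translations**: `[γ v] = [v] + c_γ`.
[cite: Timar2006, §5 (paragraph before Prop. 5.4)] -/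
theorem levelElt_map (G : SimpleGraph V) [G.LocallyFinite] (hconn : G.Connected)
    (ht : IsGraphTransitive G) (o : V) (γ : G ≃g G) (v : V) :
    levelElt G hconn ht o (γ v) = levelElt G hconn ht o v + autHeight G hconn ht o γ := by
  apply Subtype.ext
  simp only [coe_levelElt, autHeight, AddSubgroup.coe_add]
  exact levelHeight_map G hconn γ o v

/-- The translation constants form a cocycle: `c_{γ' ∘ γ} = c_γ + c_{γ'}`. [folklore] -/
theorem autHeight_trans (G : SimpleGraph V) [G.LocallyFinite] (hconn : G.Connected)
    (ht : IsGraphTransitive G) (o : V) (γ γ' : G ≃g G) :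
    autHeight G hconn ht o (γ.trans γ') = autHeight G hconn ht o γ + autHeight G hconn ht o γ' := by
  apply Subtype.ext
  simp only [autHeight, coe_levelElt, AddSubgroup.coe_add]
  change levelHeight G o (γ' (γ o)) = _
  rw [levelHeight_map G hconn γ' o (γ o)]

/-- The identity translates `R` by `0`. [folklore] -/
@[simp] theorem autHeight_refl (G : SimpleGraph V) [G.LocallyFinite] (hconn : G.Connected)
    (ht : IsGraphTransitive G) (o : V) : autHeight G hconn ht o (RelIso.refl _) = 0 := by
  apply Subtype.ext
  simp only [autHeight, coe_levelElt, AddSubgroup.coe_zero]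
  exact levelHeight_self G hconn o

/-- Same level iff same element of `R`. [cite: Timar2006, §2 and §5] -/
theorem sameLevel_iff_levelElt_eq (G : SimpleGraph V) [G.LocallyFinite] (hconn : G.Connected)
    (ht : IsGraphTransitive G) (o x y : V) :
    SameLevel G x y ↔ levelElt G hconn ht o x = levelElt G hconn ht o y := by
  rw [sameLevel_iff_levelHeight_eq G hconn o, Subtype.ext_iff, coe_levelElt, coe_levelElt]

/-! #### The exhaustion of the levels of `G` -/

/-- **The random partitions of the LEVELS of `G`**: `x ∼_m y` iff the levels of `x` and `y`, read in
`R ≅ ℤⁿ`, are in the same class of the `m`-th box partition ("the isomorphism between `R` and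
`ℤⁿ` will transfer the exhaustion to the levels"). [cite: Timar2006, Prop. 5.4] -/
def LevelExhaustionRel (G : SimpleGraph V) [G.LocallyFinite] (hconn : G.Connected)
    (ht : IsGraphTransitive G) (o : V) (m : ℕ) (ξ : ExhaustionSeeds (levelGroup G o)) (x y : V) : Prop :=
  ExhaustionRel m ξ (levelElt G hconn ht o x) (levelElt G hconn ht o y)

/-- The action of `Aut(G)` on the seeds of the level exhaustion (through `γ ↦ c_γ ∈ R`).
[cite: Timar2006, Prop. 5.4 ("invariant")] -/
def levelExhaustionAct (G : SimpleGraph V) [G.LocallyFinite] (hconn : G.Connected)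
    (ht : IsGraphTransitive G) (o : V) (γ : G ≃g G) :
    ExhaustionSeeds (levelGroup G o) → ExhaustionSeeds (levelGroup G o) :=
  exhaustionShift (autHeight G hconn ht o γ)

section

variable (G : SimpleGraph V) [G.LocallyFinite] (hconn : G.Connected) (ht : IsGraphTransitive G) (o : V)

/-- Each stage is a partition of the vertices … [cite: Timar2006, Prop. 5.4] -/
theorem levelExhaustionRel_equivalence (m : ℕ) (ξ : ExhaustionSeeds (levelGroup G o)) :
    Equivalence (LevelExhaustionRel G hconn ht o m ξ) :=
  ⟨fun _ => exhaustionRel_refl _ _ _, fun h => ExhaustionRel.symm h,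
    fun h₁ h₂ => ExhaustionRel.trans h₁ h₂⟩

/-- … saturated with respect to the levels (it is a partition of the set of levels): vertices on a
common level are related to the same vertices. [cite: Timar2006, Prop. 5.4 ("partitions the set of levels")] -/
theorem levelExhaustionRel_of_sameLevel {m : ℕ} {ξ : ExhaustionSeeds (levelGroup G o)} {x x' y : V}
    (hx : SameLevel G x x') (h : LevelExhaustionRel G hconn ht o m ξ x y) :
    LevelExhaustionRel G hconn ht o m ξ x' y := by
  unfold LevelExhaustionRel at h ⊢
  rwa [← (sameLevel_iff_levelElt_eq G hconn ht o x x').1 hx]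

/-- Saturation with respect to the levels, in the second argument. [cite: Timar2006, Prop. 5.4 ("partitions the set of levels")] -/
theorem levelExhaustionRel_of_sameLevel_right {m : ℕ} {ξ : ExhaustionSeeds (levelGroup G o)}
    {x y y' : V} (hy : SameLevel G y y') (h : LevelExhaustionRel G hconn ht o m ξ x y) :
    LevelExhaustionRel G hconn ht o m ξ x y' := by
  unfold LevelExhaustionRel at h ⊢
  rwa [← (sameLevel_iff_levelElt_eq G hconn ht o y y').1 hy]

/-- Vertices on a common level are always related. [folklore] -/
theorem levelExhaustionRel_of_sameLevel_self {m : ℕ} {ξ : ExhaustionSeeds (levelGroup G o)} {x y : V}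
    (h : SameLevel G x y) : LevelExhaustionRel G hconn ht o m ξ x y :=
  levelExhaustionRel_of_sameLevel_right G hconn ht o h ((levelExhaustionRel_equivalence G hconn ht o m ξ).refl x)

/-- **The classes are finite unions of levels**: the class of `x` at stage `m` is `levelUnion G S`
for a finite set `S` of vertices. [cite: Timar2006, Prop. 5.4 ("partitions the set of levels of G into finite sets")] -/
theorem exists_setOf_levelExhaustionRel_eq_levelUnion (m : ℕ) (ξ : ExhaustionSeeds (levelGroup G o))
    (x : V) : ∃ S : Finset V, {y | LevelExhaustionRel G hconn ht o m ξ x y} = levelUnion G S := by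
  classical
  -- the finitely many classes of `R` related to `[x]`, and one vertex on each realised one
  have hfin := finite_setOf_exhaustionRel m ξ (levelElt G hconn ht o x)
  set T : Set (levelGroup G o) := {b | ExhaustionRel m ξ (levelElt G hconn ht o x) b ∧
    ∃ y : V, levelElt G hconn ht o y = b} with hT
  have hTfin : T.Finite := hfin.subset fun b hb => hb.1
  have hchoice : ∀ b : T, ∃ y : V, levelElt G hconn ht o y = b := fun b => b.2.2
  choose f hf using hchoice
  haveI : Fintype T := hTfin.fintype
  refine ⟨Finset.univ.image f, ?_⟩
  ext y
  simp only [Set.mem_setOf_eq, mem_levelUnion_iff, Finset.mem_image, Finset.mem_univ, true_and]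
  constructor
  · intro hy
    have hbT : levelElt G hconn ht o y ∈ T := ⟨hy, y, rfl⟩
    refine ⟨f ⟨_, hbT⟩, ⟨⟨_, hbT⟩, rfl⟩, ?_⟩
    rw [sameLevel_iff_levelElt_eq G hconn ht o, hf]
  · rintro ⟨s, ⟨b, rfl⟩, hs⟩
    have h1 : LevelExhaustionRel G hconn ht o m ξ x (f b) := by
      unfold LevelExhaustionRel
      rw [hf]
      exact b.2.1
    exact levelExhaustionRel_of_sameLevel_right G hconn ht o hs h1

/-- **Invariance under `Aut(G)`**: `γ x ∼_m γ y` for the seed moved by `γ` iff `x ∼_m y`.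
[cite: Timar2006, Prop. 5.4 ("invariant random sequence")] -/
theorem levelExhaustionRel_act_iff (m : ℕ) (ξ : ExhaustionSeeds (levelGroup G o)) (γ : G ≃g G)
    (x y : V) :
    LevelExhaustionRel G hconn ht o m (levelExhaustionAct G hconn ht o γ ξ) (γ x) (γ y) ↔
      LevelExhaustionRel G hconn ht o m ξ x y := by
  unfold LevelExhaustionRel levelExhaustionAct
  rw [levelElt_map, levelElt_map, exhaustionRel_exhaustionShift_iff']

/-- The action of `Aut(G)` on the seeds is compatible with composition. [folklore] -/
theorem levelExhaustionAct_trans (γ γ' : G ≃g G) (ξ : ExhaustionSeeds (levelGroup G o)) :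
    levelExhaustionAct G hconn ht o (γ.trans γ') ξ =
      levelExhaustionAct G hconn ht o γ' (levelExhaustionAct G hconn ht o γ ξ) := by
  unfold levelExhaustionAct
  rw [autHeight_trans, add_comm, exhaustionShift_add]

/-- The identity automorphism acts trivially on the seeds. [folklore] -/
@[simp] theorem levelExhaustionAct_refl (ξ : ExhaustionSeeds (levelGroup G o)) :
    levelExhaustionAct G hconn ht o (RelIso.refl _) ξ = ξ := by
  unfold levelExhaustionAct
  rw [autHeight_refl, exhaustionShift_zero]

/-- The action is by measurable maps … [folklore] -/
theorem measurable_levelExhaustionAct (γ : G ≃g G) : Measurable (levelExhaustionAct G hconn ht o γ) :=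
  measurable_exhaustionShift _

/-- … preserving the law of the seeds. [cite: Timar2006, Prop. 5.4 ("invariant")] -/
theorem measurePreserving_levelExhaustionAct (γ : G ≃g G) :
    MeasurePreserving (levelExhaustionAct G hconn ht o γ)
      (boxSeedMeasure (LevelCoordIndex (levelGroup G o))) (boxSeedMeasure (LevelCoordIndex (levelGroup G o))) :=
  measurePreserving_exhaustionShift _

/-- The action of `Aut(G)` preserves the law of the seeds (`Measure.map` form).
[cite: Timar2006, Prop. 5.4 ("invariant")] -/
theorem map_levelExhaustionAct (γ : G ≃g G) :
    (boxSeedMeasure (LevelCoordIndex (levelGroup G o))).map (levelExhaustionAct G hconn ht o γ) =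
      boxSeedMeasure (LevelCoordIndex (levelGroup G o)) :=
  (measurePreserving_levelExhaustionAct G hconn ht o γ).map_eq

/-- The events "`x ∼_m y`" are measurable in the seed. [folklore] -/
theorem measurableSet_setOf_levelExhaustionRel (m : ℕ) (x y : V) :
    MeasurableSet {ξ | LevelExhaustionRel G hconn ht o m ξ x y} :=
  measurableSet_setOf_exhaustionRel m _ _

/-- **The exhaustion property for the levels of `G`**: any two vertices (any two levels) are in
the same class of the `m`-th partition with probability tending to `1`.
[cite: Timar2006, Prop. 5.4 ("with probability tending to 1 as i → ∞")] -/
theorem tendsto_measure_levelExhaustionRel (x y : V) :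
    Tendsto (fun m : ℕ => boxSeedMeasure (LevelCoordIndex (levelGroup G o))
      {ξ | LevelExhaustionRel G hconn ht o m ξ x y}) atTop (𝓝 1) :=
  tendsto_measure_exhaustionRel _ _ _

end

/-- **Timár 2006, Prop. 5.4 (as printed: the levels of `G`), PROVED.** For a connected, locally
finite, transitive graph `G` there is a probability space `(Ω, P)` with an action of `Aut(G)` by
measure-preserving maps and a sequence of random relations `∼_m` on the vertices such that:
each `∼_m` is an equivalence relation depending only on the levels, whose classes are finite
unions of levels ("`P_i` partitions the set of levels of `G` into finite sets"), the family is
`Aut(G)`-invariant, and any two vertices are `∼_m`-related with probability tending to `1`.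
(Nonunimodularity is not needed: for unimodular `G` there is a single level.)
[cite: Timar2006, Prop. 5.4] -/
theorem Timar2006_prop54_levels {V : Type*} (G : SimpleGraph V) [G.LocallyFinite]
    (hconn : G.Connected) (ht : IsGraphTransitive G) (o : V) :
    ∃ (Ω : Type) (_ : MeasurableSpace Ω) (P : Measure Ω) (_ : IsProbabilityMeasure P)
      (act : (G ≃g G) → Ω → Ω) (rel : ℕ → Ω → V → V → Prop),
      (∀ γ γ', act (γ.trans γ') = act γ' ∘ act γ) ∧
      (∀ γ, MeasurePreserving (act γ) P P) ∧
      (∀ m ξ, Equivalence (rel m ξ)) ∧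
      (∀ m ξ x x' y, SameLevel G x x' → rel m ξ x y → rel m ξ x' y) ∧
      (∀ m ξ x, ∃ S : Finset V, {y | rel m ξ x y} = levelUnion G S) ∧
      (∀ m ξ γ x y, rel m (act γ ξ) (γ x) (γ y) ↔ rel m ξ x y) ∧
      (∀ m x y, MeasurableSet {ξ | rel m ξ x y}) ∧
      (∀ x y, Tendsto (fun m => P {ξ | rel m ξ x y}) atTop (𝓝 1)) :=
  ⟨ExhaustionSeeds (levelGroup G o), inferInstance, boxSeedMeasure _, inferInstance,
    levelExhaustionAct G hconn ht o, LevelExhaustionRel G hconn ht o,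
    fun γ γ' => funext (levelExhaustionAct_trans G hconn ht o γ γ'),
    measurePreserving_levelExhaustionAct G hconn ht o,
    levelExhaustionRel_equivalence G hconn ht o,
    fun _ _ _ _ _ hx h => levelExhaustionRel_of_sameLevel G hconn ht o hx h,
    exists_setOf_levelExhaustionRel_eq_levelUnion G hconn ht o,
    levelExhaustionRel_act_iff G hconn ht o,
    measurableSet_setOf_levelExhaustionRel G hconn ht o,
    tendsto_measure_levelExhaustionRel G hconn ht o⟩

end LevelGroup

/-! ### Finite sets: "any set of finitely many levels of `G` is contained in the same class of
`P_i` with probability tending to 1"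

The form in which the proof of Thm. 5.5 consumes Prop. 5.4 (Timár 2006, p. 17: "the sequence
`(R_i)_i` exhausts `Φ` because any set of finitely many levels of `G` is contained in the same
class of `P_i` with probability tending to 1"; cf. `TimarExhaustionBound.lean`,
`tendsto_measure_mem_bad_of_indepFun`, whose hypothesis `μ₂ (Bad_i t) → 0` for a fixed finite set
`t` of levels is `tendsto_measure_not_forall_levelExhaustionRel` below). Union bound over the
pairs. -/

section FiniteSets

variable {ι : Type*} [Fintype ι]

/-- A finite sum of sequences tending to `0` in `ℝ≥0∞` tends to `0`. [folklore] -/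
theorem ENNReal.tendsto_finset_sum_zero {α : Type*} (S : Finset α) {f : α → ℕ → ℝ≥0∞}
    (hf : ∀ a ∈ S, Tendsto (f a) atTop (𝓝 0)) :
    Tendsto (fun m => ∑ a ∈ S, f a m) atTop (𝓝 0) := by
  have h := tendsto_finsetSum S hf
  rwa [Finset.sum_const_zero] at h

variable (ι) in
/-- **A fixed finite set is inside one class of `P_m` with probability `→ 1`** (complement form,
box exhaustion of `ℤ^ι`): `P[¬ ∀ v w ∈ S, v ∼_m w] → 0`.
[cite: Timar2006, Thm. 5.5 (proof: "any set of finitely many levels of G is contained in the same class of P_i with probability tending to 1")] -/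
theorem tendsto_measure_not_forall_boxRel (S : Finset (ι → ℤ)) :
    Tendsto (fun m : ℕ => boxSeedMeasure ι {ξ | ¬ ∀ v ∈ S, ∀ w ∈ S, BoxRel m ξ v w}) atTop (𝓝 0) := by
  have hsub : ∀ m : ℕ, {ξ : BoxSeeds ι | ¬ ∀ v ∈ S, ∀ w ∈ S, BoxRel m ξ v w} ⊆
      ⋃ v ∈ S, ⋃ w ∈ S, {ξ | ¬ BoxRel m ξ v w} := by
    intro m ξ hξ
    simp only [Set.mem_setOf_eq, not_forall] at hξ
    obtain ⟨v, hv, w, hw, h⟩ := hξ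
    simp only [Set.mem_iUnion, Set.mem_setOf_eq]
    exact ⟨v, hv, w, hw, h⟩
  have hle : ∀ m : ℕ, boxSeedMeasure ι {ξ | ¬ ∀ v ∈ S, ∀ w ∈ S, BoxRel m ξ v w} ≤
      ∑ v ∈ S, ∑ w ∈ S, boxSeedMeasure ι {ξ | ¬ BoxRel m ξ v w} := fun m =>
    (measure_mono (hsub m)).trans ((measure_biUnion_finset_le S _).trans
      (Finset.sum_le_sum fun v _ => measure_biUnion_finset_le S _))
  refine tendsto_of_tendsto_of_tendsto_of_le_of_le tendsto_const_nhds ?_ (fun m => zero_le) hle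
  exact ENNReal.tendsto_finset_sum_zero S fun v _ =>
    ENNReal.tendsto_finset_sum_zero S fun w _ => tendsto_measure_not_boxRel ι v w

/-- The event "the finite set `S` is inside one class of `P_m`" is measurable. [folklore] -/
theorem measurableSet_setOf_forall_boxRel (m : ℕ) (S : Finset (ι → ℤ)) :
    MeasurableSet {ξ : BoxSeeds ι | ∀ v ∈ S, ∀ w ∈ S, BoxRel m ξ v w} := by
  have h : {ξ : BoxSeeds ι | ∀ v ∈ S, ∀ w ∈ S, BoxRel m ξ v w} =
      ⋂ v ∈ S, ⋂ w ∈ S, {ξ | BoxRel m ξ v w} := by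
    ext ξ; simp only [Set.mem_setOf_eq, Set.mem_iInter]
  rw [h]
  exact Finset.measurableSet_biInter S fun v _ =>
    Finset.measurableSet_biInter S fun w _ => measurableSet_setOf_boxRel m v w

variable (ι) in
/-- **A fixed finite set is inside one class of `P_m` with probability `→ 1`** (box exhaustion).
[cite: Timar2006, Thm. 5.5 (proof) and Prop. 5.4] -/
theorem tendsto_measure_forall_boxRel (S : Finset (ι → ℤ)) :
    Tendsto (fun m : ℕ => boxSeedMeasure ι {ξ | ∀ v ∈ S, ∀ w ∈ S, BoxRel m ξ v w}) atTop (𝓝 1) := by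
  have h : ∀ m : ℕ, boxSeedMeasure ι {ξ | ∀ v ∈ S, ∀ w ∈ S, BoxRel m ξ v w} =
      1 - boxSeedMeasure ι {ξ | ¬ ∀ v ∈ S, ∀ w ∈ S, BoxRel m ξ v w} := by
    intro m
    have hc : {ξ : BoxSeeds ι | ¬ ∀ v ∈ S, ∀ w ∈ S, BoxRel m ξ v w} =
        {ξ | ∀ v ∈ S, ∀ w ∈ S, BoxRel m ξ v w}ᶜ := rfl
    rw [hc, prob_compl_eq_one_sub (measurableSet_setOf_forall_boxRel m S),
      ENNReal.sub_sub_cancel ENNReal.one_ne_top prob_le_one]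
  simp_rw [h]
  have h1 := ENNReal.Tendsto.sub (tendsto_const_nhds (x := (1 : ℝ≥0∞)))
    (tendsto_measure_not_forall_boxRel ι S) (Or.inl ENNReal.one_ne_top)
  rwa [tsub_zero] at h1

end FiniteSets

section FiniteSetsTransfer

universe u

variable {Λ : Type u} [AddCommGroup Λ] [Module.Free ℤ Λ] [Module.Finite ℤ Λ]

/-- Finite sets of `Λ` are inside one class of `P_m` with probability `→ 1` (complement form).
[cite: Timar2006, Thm. 5.5 (proof) and Prop. 5.4] -/
theorem tendsto_measure_not_forall_exhaustionRel [DecidableEq Λ] (S : Finset Λ) :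
    Tendsto (fun m : ℕ => boxSeedMeasure (LevelCoordIndex Λ)
      {ξ | ¬ ∀ a ∈ S, ∀ b ∈ S, ExhaustionRel m ξ a b}) atTop (𝓝 0) := by
  classical
  have h : ∀ m : ℕ, {ξ : ExhaustionSeeds Λ | ¬ ∀ a ∈ S, ∀ b ∈ S, ExhaustionRel m ξ a b} =
      {ξ | ¬ ∀ v ∈ S.image (levelCoord Λ), ∀ w ∈ S.image (levelCoord Λ), BoxRel m ξ v w} := by
    intro m; ext ξ
    simp only [Set.mem_setOf_eq, Finset.forall_mem_image, ExhaustionRel]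
  simp_rw [h]
  exact tendsto_measure_not_forall_boxRel _ _

/-- The event "the finite set `S ⊆ Λ` is inside one class of `P_m`" is measurable. [folklore] -/
theorem measurableSet_setOf_forall_exhaustionRel (m : ℕ) (S : Finset Λ) :
    MeasurableSet {ξ : ExhaustionSeeds Λ | ∀ a ∈ S, ∀ b ∈ S, ExhaustionRel m ξ a b} := by
  have h : {ξ : ExhaustionSeeds Λ | ∀ a ∈ S, ∀ b ∈ S, ExhaustionRel m ξ a b} =
      ⋂ a ∈ S, ⋂ b ∈ S, {ξ | ExhaustionRel m ξ a b} := by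
    ext ξ; simp only [Set.mem_setOf_eq, Set.mem_iInter]
  rw [h]
  exact Finset.measurableSet_biInter S fun a _ =>
    Finset.measurableSet_biInter S fun b _ => measurableSet_setOf_exhaustionRel m a b

/-- Finite sets of `Λ` are inside one class of `P_m` with probability `→ 1`.
[cite: Timar2006, Thm. 5.5 (proof) and Prop. 5.4] -/
theorem tendsto_measure_forall_exhaustionRel [DecidableEq Λ] (S : Finset Λ) :
    Tendsto (fun m : ℕ => boxSeedMeasure (LevelCoordIndex Λ)
      {ξ | ∀ a ∈ S, ∀ b ∈ S, ExhaustionRel m ξ a b}) atTop (𝓝 1) := by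
  classical
  have h : ∀ m : ℕ, {ξ : ExhaustionSeeds Λ | ∀ a ∈ S, ∀ b ∈ S, ExhaustionRel m ξ a b} =
      {ξ | ∀ v ∈ S.image (levelCoord Λ), ∀ w ∈ S.image (levelCoord Λ), BoxRel m ξ v w} := by
    intro m; ext ξ
    simp only [Set.mem_setOf_eq, Finset.forall_mem_image, ExhaustionRel]
  simp_rw [h]
  exact tendsto_measure_forall_boxRel _ _

end FiniteSetsTransfer

section FiniteSetsLevels

open Literature.Probability.LatticeModels Literature.Probability.Percolation

variable {V : Type*} (G : SimpleGraph V) [G.LocallyFinite] (hconn : G.Connected)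
  (ht : IsGraphTransitive G) (o : V)

/-- **"Any set of finitely many levels of `G` is contained in the same class of `P_i` with
probability tending to 1"** — for the levels of the finitely many vertices `S` (complement form,
the hypothesis `μ₂ (Bad_i t) → 0` of `TimarExhaustionBound.lean`).
[cite: Timar2006, Thm. 5.5 (proof, last paragraph) and Prop. 5.4] -/
theorem tendsto_measure_not_forall_levelExhaustionRel (S : Finset V) :
    Tendsto (fun m : ℕ => boxSeedMeasure (LevelCoordIndex (levelGroup G o))
      {ξ | ¬ ∀ x ∈ S, ∀ y ∈ S, LevelExhaustionRel G hconn ht o m ξ x y}) atTop (𝓝 0) := by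
  classical
  have h : ∀ m : ℕ, {ξ : ExhaustionSeeds (levelGroup G o) |
      ¬ ∀ x ∈ S, ∀ y ∈ S, LevelExhaustionRel G hconn ht o m ξ x y} =
      {ξ | ¬ ∀ a ∈ S.image (levelElt G hconn ht o), ∀ b ∈ S.image (levelElt G hconn ht o),
        ExhaustionRel m ξ a b} := by
    intro m; ext ξ
    simp only [Set.mem_setOf_eq, Finset.forall_mem_image, LevelExhaustionRel]
  simp_rw [h]
  exact tendsto_measure_not_forall_exhaustionRel _

/-- The event "the levels of `S` are inside one class of `P_m`" is measurable. [folklore] -/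
theorem measurableSet_setOf_forall_levelExhaustionRel (m : ℕ) (S : Finset V) :
    MeasurableSet {ξ : ExhaustionSeeds (levelGroup G o) |
      ∀ x ∈ S, ∀ y ∈ S, LevelExhaustionRel G hconn ht o m ξ x y} := by
  have h : {ξ : ExhaustionSeeds (levelGroup G o) |
      ∀ x ∈ S, ∀ y ∈ S, LevelExhaustionRel G hconn ht o m ξ x y} =
      ⋂ x ∈ S, ⋂ y ∈ S, {ξ | LevelExhaustionRel G hconn ht o m ξ x y} := by
    ext ξ; simp only [Set.mem_setOf_eq, Set.mem_iInter]
  rw [h]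
  exact Finset.measurableSet_biInter S fun x _ =>
    Finset.measurableSet_biInter S fun y _ => measurableSet_setOf_levelExhaustionRel G hconn ht o m x y

/-- The levels of finitely many vertices are inside one class of `P_m` with probability `→ 1`.
[cite: Timar2006, Thm. 5.5 (proof, last paragraph) and Prop. 5.4] -/
theorem tendsto_measure_forall_levelExhaustionRel (S : Finset V) :
    Tendsto (fun m : ℕ => boxSeedMeasure (LevelCoordIndex (levelGroup G o))
      {ξ | ∀ x ∈ S, ∀ y ∈ S, LevelExhaustionRel G hconn ht o m ξ x y}) atTop (𝓝 1) := by
  classical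
  have h : ∀ m : ℕ, {ξ : ExhaustionSeeds (levelGroup G o) |
      ∀ x ∈ S, ∀ y ∈ S, LevelExhaustionRel G hconn ht o m ξ x y} =
      {ξ | ∀ a ∈ S.image (levelElt G hconn ht o), ∀ b ∈ S.image (levelElt G hconn ht o),
        ExhaustionRel m ξ a b} := by
    intro m; ext ξ
    simp only [Set.mem_setOf_eq, Finset.forall_mem_image, LevelExhaustionRel]
  simp_rw [h]
  exact tendsto_measure_forall_exhaustionRel _

end FiniteSetsLevels

end Literature.Barriers.CriticalPhenomena

end
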